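import Mathlib.Analysis.SpecialFunctions.Pow.Asymptotics
import Mathlib.Analysis.SpecialFunctions.Log.NegMulLog
import Mathlib.Analysis.Complex.ExponentialBounds
import HarnessLib

/-!
# Tao's log-averaged Elliott theorem: the real-variable bookkeeping of the hierarchy of parameters

Part of the proof DAG below the named fact `Literature.NumberTheory.LFunctions.Tao2016_theorem23_core` (Tao, Forum Math. Pi 4
(2016) e8, proof of Theorem 2.3).  The paper works in the hierarchy "`ε > 0`; `H₋` sufficiently
large depending on `a, b, h, ε`; `H₊` sufficiently large depending on `H₋`; `A` sufficiently
large depending on `H₊`" and freely writes `o(1)`.  The Lean assembly (`TaoLogElliottCore.lean`)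
makes every threshold explicit; this file isolates the purely real-variable inequalities it
needs, so that the number-theoretic files stay readable:

* `le_div_log_of_sq_le` — `H / log H → ∞` quantitatively (through a private copy of the
  elementary `log y ≤ 2√y`, which also lives in `SelbergSymmetryFormula.lean`; that file is not
  imported here to keep this one Mathlib-only);
* `negMulLog_add_le` — `-u log u + u ≤ 3 √u` on `[0, 1]` (the continuity modulus of entropy);
* `eventually_log_log_pow_le` — `(log log H)^9 = o(log H)`;
* `ratio_bound` — the error `(log 2 + η + τ)/θ + (κ + η)/τ ≤ 4 ε³` for the choices
  `θ = ε⁷H/log H`, `τ = ε¹⁰ H/log H`, `κ = ε¹³ H/log H`, `η ≤ 1` of the decoupling step;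
* `eta_le_one` — the near-uniformity error `P (φ(u) + u) ≤ 1` once `S` is large (`φ = -u log u`);
* `endgame_numeric` — the final contradiction `ε ≪_{a,h} ε₁² + |Ξ_H| · o(1)` is impossible for
  the chosen `ε₁` once `H₋` and `A` are large.

## References
* T. Tao, Forum Math. Pi 4 (2016), e8; arXiv:1509.05422, §2 (the hierarchy of parameters after
  (2.8)) and §3 (concluding paragraph of the proof of Theorem 2.3).
-/

open Real Filter

namespace Literature.NumberTheory.LFunctions

namespace Tao2016

namespace Numeric

/-- `log y ≤ 2 √y` for `y > 0` (private copy of `Literature.NumberTheory.Sieve.SelbergSymmetry.log_le_two_mul_sqrt`, whose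
file is too heavy to import into this Mathlib-only one). [folklore] -/
private theorem log_le_two_sqrt {y : ℝ} (hy : 0 < y) : Real.log y ≤ 2 * Real.sqrt y := by
  have h1 : Real.log (Real.sqrt y) ≤ Real.sqrt y - 1 := Real.log_le_sub_one_of_pos (Real.sqrt_pos.2 hy)
  have h2 : Real.log (Real.sqrt y) = Real.log y / 2 := by
    rw [Real.log_sqrt hy.le]
  rw [h2] at h1
  linarith [Real.sqrt_nonneg y]

/-- `K ≤ H / log H` once `H ≥ 16 K² + 16` (`K ≥ 0`). [folklore] -/
theorem le_div_log_of_sq_le {K : ℝ} (hK : 0 ≤ K) {H : ℕ} (hH : 16 * K ^ 2 + 16 ≤ (H : ℝ)) :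
    K ≤ H / Real.log H := by
  have hH16 : (16 : ℝ) ≤ H := by nlinarith
  have hH0 : (0 : ℝ) < H := by linarith
  have hlog : 0 < Real.log H := Real.log_pos (by linarith)
  have hsq : Real.log H ≤ 2 * Real.sqrt H := log_le_two_sqrt hH0
  rw [le_div_iff₀ hlog]
  have hs0 : 0 ≤ Real.sqrt H := Real.sqrt_nonneg _
  have hsq2 : Real.sqrt H * Real.sqrt H = H := Real.mul_self_sqrt hH0.le
  -- `2K ≤ √H`
  have h2K : 2 * K ≤ Real.sqrt H := by
    have : (2 * K) ^ 2 ≤ H := by nlinarith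
    calc 2 * K = Real.sqrt ((2 * K) ^ 2) := by rw [Real.sqrt_sq (by positivity)]
      _ ≤ Real.sqrt H := Real.sqrt_le_sqrt this
  calc K * Real.log H ≤ K * (2 * Real.sqrt H) := mul_le_mul_of_nonneg_left hsq hK
    _ = 2 * K * Real.sqrt H := by ring
    _ ≤ Real.sqrt H * Real.sqrt H := mul_le_mul_of_nonneg_right h2K hs0
    _ = H := hsq2

/-- `(log log H)^9 ≤ c log H` eventually, for every `c > 0`. [folklore] -/
theorem eventually_log_log_pow_le {c : ℝ} (hc : 0 < c) :
    ∀ᶠ H : ℕ in atTop, Real.log (Real.log H) ^ 9 ≤ c * Real.log H := by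
  have h1 : (fun y : ℝ => Real.log y ^ 9) =o[atTop] id := isLittleO_pow_log_id_atTop
  have h2 : Tendsto (fun H : ℕ => Real.log (H : ℝ)) atTop atTop :=
    Real.tendsto_log_atTop.comp tendsto_natCast_atTop_atTop
  have h3 := (h1.comp_tendsto h2).bound hc
  have h4 : ∀ᶠ H : ℕ in atTop, 1 ≤ Real.log (H : ℝ) := h2.eventually_ge_atTop 1
  filter_upwards [h3, h4] with H hH hH1
  have hl0 : 0 ≤ Real.log (Real.log (H : ℝ)) := Real.log_nonneg hH1
  have e1 : ‖((fun y : ℝ => Real.log y ^ 9) ∘ fun H : ℕ => Real.log (H : ℝ)) H‖ =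
      Real.log (Real.log H) ^ 9 := by
    simp only [Function.comp]
    rw [Real.norm_eq_abs, abs_of_nonneg (pow_nonneg hl0 9)]
  have e2 : ‖(id ∘ fun H : ℕ => Real.log (H : ℝ)) H‖ = Real.log H := by
    simp only [Function.comp, id]
    rw [Real.norm_eq_abs, abs_of_nonneg (by linarith)]
  rw [e1, e2] at hH
  exact hH

/-- The error of the decoupling step for the standard choices: with `L = log H > 0`,
`θ = ε⁷H/L`, `τ = ε¹⁰H/L`, `κ = ε¹³H/L`, `η ≤ 1`, `2L ≤ ε¹⁰ H`, `L ≤ ε¹³ H`, `0 < ε`: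
`(log 2 + η + τ)/θ + (κ + η)/τ ≤ 4 ε³`. [folklore] -/
theorem ratio_bound {ε H L η : ℝ} (hε : 0 < ε) (hH : 0 < H) (hL : 0 < L)
    (hη1 : η ≤ 1) (h10 : 2 * L ≤ ε ^ 10 * H) (h13 : L ≤ ε ^ 13 * H) :
    (Real.log 2 + η + ε ^ 10 * H / L) / (ε ^ 7 * H / L) +
        (ε ^ 13 * H / L + η) / (ε ^ 10 * H / L) ≤ 4 * ε ^ 3 := by
  have hlog2 : Real.log 2 ≤ 1 := by have := Real.log_two_lt_d9; linarith
  have hθ : 0 < ε ^ 7 * H / L := by positivity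
  have hτ : 0 < ε ^ 10 * H / L := by positivity
  have h1 : (Real.log 2 + η + ε ^ 10 * H / L) / (ε ^ 7 * H / L) ≤ 2 * ε ^ 3 := by
    rw [div_le_iff₀ hθ]
    have : Real.log 2 + η ≤ 2 := by linarith
    -- `2 ≤ ε³ · ε⁷ H / L` iff `2 L ≤ ε¹⁰ H`
    have h2 : (2 : ℝ) ≤ ε ^ 3 * (ε ^ 7 * H / L) := by
      rw [show ε ^ 3 * (ε ^ 7 * H / L) = ε ^ 10 * H / L by ring, le_div_iff₀ hL]
      linarith
    have h3 : ε ^ 10 * H / L = ε ^ 3 * (ε ^ 7 * H / L) := by ring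
    linarith
  have h2 : (ε ^ 13 * H / L + η) / (ε ^ 10 * H / L) ≤ 2 * ε ^ 3 := by
    rw [div_le_iff₀ hτ]
    have h4 : η ≤ ε ^ 3 * (ε ^ 10 * H / L) := by
      rw [show ε ^ 3 * (ε ^ 10 * H / L) = ε ^ 13 * H / L by ring, le_div_iff₀ hL]
      have : η * L ≤ 1 * L := mul_le_mul_of_nonneg_right hη1 hL.le
      linarith
    have h5 : ε ^ 13 * H / L = ε ^ 3 * (ε ^ 10 * H / L) := by ring
    linarith
  linarith

/-- `-u log u + u ≤ 3 √u` for `0 ≤ u ≤ 1`. [folklore] -/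
theorem negMulLog_add_le {u : ℝ} (h0 : 0 ≤ u) (h1 : u ≤ 1) : negMulLog u + u ≤ 3 * Real.sqrt u := by
  rcases h0.eq_or_lt with rfl | hpos
  · simp [negMulLog]
  have hsq : 0 < Real.sqrt u := Real.sqrt_pos.2 hpos
  have hsq1 : Real.sqrt u ≤ 1 := Real.sqrt_le_one.mpr h1
  have hlog : Real.log (1 / Real.sqrt u) ≤ 1 / Real.sqrt u - 1 :=
    Real.log_le_sub_one_of_pos (by positivity)
  have h2 : negMulLog u = 2 * u * Real.log (1 / Real.sqrt u) := by
    rw [negMulLog, one_div, Real.log_inv, Real.log_sqrt h0]; ring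
  have h3 : u * (1 / Real.sqrt u) = Real.sqrt u := by
    rw [one_div, ← div_eq_mul_inv, Real.div_sqrt]
  have hule : u ≤ Real.sqrt u := by
    calc u = Real.sqrt u * Real.sqrt u := (Real.mul_self_sqrt h0).symm
      _ ≤ Real.sqrt u * 1 := by gcongr
      _ = Real.sqrt u := mul_one _
  rw [h2]
  calc 2 * u * Real.log (1 / Real.sqrt u) + u ≤ 2 * u * (1 / Real.sqrt u - 1) + u := by gcongr
    _ = 2 * (u * (1 / Real.sqrt u)) - u := by ring
    _ = 2 * Real.sqrt u - u := by rw [h3]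
    _ ≤ 3 * Real.sqrt u := by linarith

/-- The near-uniformity error `η = P (φ(u) + u)`, `u = (8 + 2 log P)/S`, is `≤ 1` and `u ≤ 1`
once `P ≤ 4^{H₊}` and `S ≥ 9 · 16^{H₊} (8 + 4 H₊)` (so "`A` sufficiently large depending on
`H₊`"). [folklore] -/
theorem eta_le_one {P Hp : ℕ} (hP : 0 < P) (hPle : P ≤ 4 ^ Hp) {S : ℝ}
    (hS : (9 : ℝ) * 16 ^ Hp * (8 + 4 * Hp) ≤ S) :
    (8 + 2 * Real.log P) / S ≤ 1 ∧ 8 + 2 * Real.log P ≤ S ∧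
      (P : ℝ) * (negMulLog ((8 + 2 * Real.log P) / S) + (8 + 2 * Real.log P) / S) ≤ 1 := by
  have hP1 : (1 : ℝ) ≤ P := by exact_mod_cast hP
  have hPR : (P : ℝ) ≤ (4 : ℝ) ^ Hp := by exact_mod_cast hPle
  have hlog4 : Real.log 4 ≤ 2 := by
    have := Real.log_two_lt_d9
    rw [show (4 : ℝ) = 2 ^ 2 by norm_num, Real.log_pow]; push_cast; linarith
  have hlogP : Real.log P ≤ 2 * Hp := by
    calc Real.log P ≤ Real.log ((4 : ℝ) ^ Hp) := Real.log_le_log (by linarith) hPR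
      _ = Hp * Real.log 4 := by rw [Real.log_pow]
      _ ≤ Hp * 2 := mul_le_mul_of_nonneg_left hlog4 (Nat.cast_nonneg _)
      _ = 2 * Hp := by ring
  have hlogP0 : 0 ≤ Real.log P := Real.log_nonneg hP1
  have h16 : (1 : ℝ) ≤ 16 ^ Hp := one_le_pow₀ (by norm_num)
  have hnum : 8 + 2 * Real.log P ≤ 8 + 4 * Hp := by linarith
  have hnum0 : 0 < 8 + 2 * Real.log P := by linarith
  have hS0 : 0 < S := by
    have : (0 : ℝ) < 9 * 16 ^ Hp * (8 + 4 * Hp) := by positivity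
    linarith
  have hSge : 8 + 4 * (Hp : ℝ) ≤ S := by
    have : 8 + 4 * (Hp : ℝ) ≤ 9 * 16 ^ Hp * (8 + 4 * Hp) := by nlinarith
    linarith
  have hu1 : (8 + 2 * Real.log P) / S ≤ 1 := by
    rw [div_le_one hS0]; linarith
  have hu0 : 0 ≤ (8 + 2 * Real.log P) / S := by positivity
  refine ⟨hu1, by linarith, ?_⟩
  have hφ := negMulLog_add_le hu0 hu1
  -- `P · 3 √u ≤ 1` iff `9 P² u ≤ 1`
  have hsqrt : Real.sqrt ((8 + 2 * Real.log P) / S) ≤ 1 / (3 * 4 ^ Hp) := by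
    rw [Real.sqrt_le_left (by positivity)]
    rw [div_le_iff₀ hS0]
    have : (1 / (3 * 4 ^ Hp) : ℝ) ^ 2 * S = S / (9 * 16 ^ Hp) := by
      rw [show ((16 : ℝ) ^ Hp) = (4 ^ Hp) ^ 2 by rw [← pow_mul, mul_comm, pow_mul]; norm_num]
      field_simp
      ring
    rw [this, le_div_iff₀ (by positivity)]
    calc (8 + 2 * Real.log P) * (9 * 16 ^ Hp) ≤ (8 + 4 * Hp) * (9 * 16 ^ Hp) :=
          mul_le_mul_of_nonneg_right hnum (by positivity)
      _ = 9 * 16 ^ Hp * (8 + 4 * Hp) := by ring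
      _ ≤ S := hS
  calc (P : ℝ) * (negMulLog ((8 + 2 * Real.log P) / S) + (8 + 2 * Real.log P) / S)
      ≤ (4 : ℝ) ^ Hp * (3 * Real.sqrt ((8 + 2 * Real.log P) / S)) :=
        mul_le_mul hPR hφ (add_nonneg (negMulLog_nonneg hu0 hu1) hu0) (by positivity)
    _ ≤ (4 : ℝ) ^ Hp * (3 * (1 / (3 * 4 ^ Hp))) := by gcongr
    _ = 1 := by field_simp

/-- **The final contradiction is impossible** (Tao 2016, end of §3: "`ε ≪_{a,h} ε² + o(|Ξ_H|)`
… leads to the desired contradiction by choosing `ε` small enough"): for `ε₁ ≤ ε/(256 a (6|h| + 286))`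
and the explicit largeness of `H₋` (`hll`) and of `A` (`hS4`), the inequality delivered by
`endgame_bound` cannot hold. [cite: TaoFMP2016, §3 (concluding paragraph of the proof of Theorem 2.3)] -/
theorem endgame_numeric {ε a hR ε₁ CΞ C Ξc B S L logω Hp8 : ℝ}
    (hε : 0 < ε) (ha : 1 ≤ a) (hh0 : 0 ≤ hR) (hε₁ : 0 < ε₁) (hε₁1 : ε₁ ≤ 1)
    (hε₁ε : ε₁ ≤ ε / (256 * a * (6 * hR + 286)))
    (hCΞ : 0 < CΞ) (hC : 0 ≤ C) (hS1 : 1 ≤ S) (hL : 0 < L) (hlogL0 : 0 ≤ Real.log L)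
    (hlogL : Real.log L ^ 8 ≤ Hp8)
    (hΞ : Ξc ≤ CΞ * a * ε₁⁻¹ ^ 10 * Real.log L ^ 8)
    (hB : B ≤ C * (Real.log L / L) * logω) (hB0 : 0 ≤ B) (hlogω : logω ≤ S + 1)
    (hll : (6 + 3 * hR) * CΞ * a ^ 2 * ε₁⁻¹ ^ 10 * (2 * C) * Real.log L ^ 9 ≤ ε / (512 * a) * L)
    (hS4 : 512 * a ^ 3 * (6 + 3 * hR) * CΞ * ε₁⁻¹ ^ 10 * Hp8 * (8 + 2 * Real.log a) ≤ ε * S)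
    (hend : ε / (64 * a) ≤ (6 + 3 * hR) * (ε₁ ^ 2 + Ξc * (a * (B + 8 + 2 * Real.log a) / S))) :
    False := by
  have ha0 : 0 < a := by linarith
  have hS0 : 0 < S := by linarith
  have hloga : 0 ≤ Real.log a := Real.log_nonneg ha
  have hK : 0 < 6 + 3 * hR := by positivity
  have hK' : 6 + 3 * hR ≤ 6 * hR + 286 := by linarith
  -- first term
  have t1 : (6 + 3 * hR) * ε₁ ^ 2 ≤ ε / (256 * a) := by
    have hsq : ε₁ ^ 2 ≤ ε₁ := by nlinarith
    have h1 : (6 + 3 * hR) * ε₁ ≤ (6 * hR + 286) * (ε / (256 * a * (6 * hR + 286))) :=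
      mul_le_mul hK' hε₁ε hε₁.le (by positivity)
    have h2 : (6 * hR + 286) * (ε / (256 * a * (6 * hR + 286))) = ε / (256 * a) := by
      field_simp
    nlinarith
  -- the `τ₀` factor
  set NΞ : ℝ := CΞ * a * ε₁⁻¹ ^ 10 * Real.log L ^ 8 with hNΞ
  have hNΞ0 : 0 ≤ NΞ := by rw [hNΞ]; positivity
  have hτ0 : 0 ≤ a * (B + 8 + 2 * Real.log a) / S := by positivity
  have t2a : Ξc * (a * (B + 8 + 2 * Real.log a) / S) ≤ NΞ * (a * (B + 8 + 2 * Real.log a) / S) :=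
    mul_le_mul_of_nonneg_right hΞ hτ0
  -- split `τ₀ = a B / S + a (8 + 2 log a) / S`
  have hBS : a * B / S ≤ 2 * a * C * (Real.log L / L) := by
    have h1 : B ≤ C * (Real.log L / L) * (S + 1) :=
      hB.trans (mul_le_mul_of_nonneg_left hlogω (by positivity))
    have h2 : (S + 1) / S ≤ 2 := by rw [div_le_iff₀ hS0]; linarith
    calc a * B / S ≤ a * (C * (Real.log L / L) * (S + 1)) / S := by gcongr
      _ = a * C * (Real.log L / L) * ((S + 1) / S) := by field_simp
      _ ≤ a * C * (Real.log L / L) * 2 := by gcongr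
      _ = 2 * a * C * (Real.log L / L) := by ring
  have t2b : (6 + 3 * hR) * (NΞ * (a * B / S)) ≤ ε / (512 * a) := by
    calc (6 + 3 * hR) * (NΞ * (a * B / S)) ≤ (6 + 3 * hR) * (NΞ * (2 * a * C * (Real.log L / L))) := by
          gcongr
      _ = ((6 + 3 * hR) * CΞ * a ^ 2 * ε₁⁻¹ ^ 10 * (2 * C) * Real.log L ^ 9) / L := by
          rw [hNΞ]; field_simp
      _ ≤ (ε / (512 * a) * L) / L := div_le_div_of_nonneg_right hll hL.le
      _ = ε / (512 * a) := by field_simp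
  have t2c : (6 + 3 * hR) * (NΞ * (a * (8 + 2 * Real.log a) / S)) ≤ ε / (512 * a) := by
    have h1 : NΞ ≤ CΞ * a * ε₁⁻¹ ^ 10 * Hp8 := by
      rw [hNΞ]; gcongr
    calc (6 + 3 * hR) * (NΞ * (a * (8 + 2 * Real.log a) / S))
        ≤ (6 + 3 * hR) * (CΞ * a * ε₁⁻¹ ^ 10 * Hp8 * (a * (8 + 2 * Real.log a) / S)) := by gcongr
      _ = (512 * a ^ 3 * (6 + 3 * hR) * CΞ * ε₁⁻¹ ^ 10 * Hp8 * (8 + 2 * Real.log a)) /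
            (512 * a * S) := by field_simp
      _ ≤ (ε * S) / (512 * a * S) := div_le_div_of_nonneg_right hS4 (by positivity)
      _ = ε / (512 * a) := by field_simp
  have hsplit : NΞ * (a * (B + 8 + 2 * Real.log a) / S) =
      NΞ * (a * B / S) + NΞ * (a * (8 + 2 * Real.log a) / S) := by
    field_simp; ring
  have t2 : (6 + 3 * hR) * (Ξc * (a * (B + 8 + 2 * Real.log a) / S)) ≤ ε / (512 * a) + ε / (512 * a) := by
    calc (6 + 3 * hR) * (Ξc * (a * (B + 8 + 2 * Real.log a) / S))
        ≤ (6 + 3 * hR) * (NΞ * (a * (B + 8 + 2 * Real.log a) / S)) :=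
          mul_le_mul_of_nonneg_left t2a hK.le
      _ = (6 + 3 * hR) * (NΞ * (a * B / S)) + (6 + 3 * hR) * (NΞ * (a * (8 + 2 * Real.log a) / S)) := by
          rw [hsplit]; ring
      _ ≤ ε / (512 * a) + ε / (512 * a) := add_le_add t2b t2c
  have hexp : (6 + 3 * hR) * (ε₁ ^ 2 + Ξc * (a * (B + 8 + 2 * Real.log a) / S)) =
      (6 + 3 * hR) * ε₁ ^ 2 + (6 + 3 * hR) * (Ξc * (a * (B + 8 + 2 * Real.log a) / S)) := by ring
  rw [hexp] at hend
  have h128 : ε / (256 * a) + (ε / (512 * a) + ε / (512 * a)) = ε / (128 * a) := by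
    field_simp; ring
  have hlt : ε / (128 * a) < ε / (64 * a) := by
    rw [div_lt_div_iff₀ (by positivity) (by positivity)]
    nlinarith
  linarith

end Numeric

end Tao2016

end Literature.NumberTheory.LFunctions
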